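import Literature.MathematicalPhysics.QuantumFieldTheory.Balaban1983to89.T4TowerRateDischarge
import Literature.MathematicalPhysics.QuantumFieldTheory.Balaban1983to89.T4BetaReadOutLipschitz
import Literature.MathematicalPhysics.QuantumFieldTheory.Balaban1983to89.T4CurrencyMatching
import Summits.QuantumFields.BalabanUV.T4Continuum.Support.NE9MarginalProjectionEnd

/-!
# NE4ReadOutSocketMarginal — binder row NE4 (spine node U2) on row NE9's MARGINAL-PROJECTION END: ONE read-out, TWO uses
# (cell `pub-balaban`, T⁴-continuum fan-out, `HOME/BINDER-OWNERS.md` row NE4, owner lineage t4-ne4-p1, generation 35;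
# technique lane P1 = discrete Grönwall / fading memory)

HONEST FRAMING (T4-DAG PAGE 1).  The cell's T⁴ target is rung (B)+1: existence AND uniqueness of the ε → 0 limit of
gauge-invariant observables on a FIXED finite torus T⁴ — NOT infinite volume, NOT a mass gap, NOT the Clay problem.  The
spine estimate NE4 («η-rate of the full β_k», shape `T4CouplingMatching.ScaleShiftRate`) is NOT PRINTED in
[Balaban1987RG1]–[Balaban1989LargeFieldII] and NOT PROVED here: node U2 is DEPENDENT — (R)∘{NE5, NE9} — and NE5, NE9 are the
cell's own estimates, NOT PRINTED, NOT PROVED (spine estimates proved: 0/9, unchanged by this module).  Nothing printed is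
asserted; [I] = [Balaban1987RG1] is quoted for TYPES/STRUCTURE only (ABSOLUTE RULE).  `FlowStep.BetaPertH`, (B), (B^μ) do
not occur and are NOT hidden: they live in the window `W` / the runs of whoever instantiates.  HONEST DEPENDENCY (cell,
verbatim): continuum YM on T⁴ ⇐ BetaPertH ∧ nine spine estimates (0/9 proved); BetaPertH ⇐ (D1) ∧ (D4) ∧ CAP+tail;
G-an2-4 gates asym, D1 and NE2/3/4.

WHAT THIS MODULE IS.  Row NE9 (generation 22) re-typed its END: the history channel of the NE9 frame is fed MARGINAL-FREE
old terms, `T := 𝒯 ∘ margProj r A` (`Support/NE9MarginalProjection`, `Support/NE9MarginalProjectionEnd`, p208622/p208940;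
necessity toy `NE9MarginalProjectionEnd.not_fading_on_full_class`: on a class containing a marginal direction the per-step
size binder holds for NO fading profile).  The projection's read-out `r` has three binders — `ReadSize` (constant `cr`),
`ReadAdditive`, `ReadZero` — and row NE9 built the junction `NE9MarginalProjection.readSize_of_readBoundedOn` with node U2's
(R) binder `T4BetaReadOutLipschitz.ReadBoundedOn` BY NAME.  This leaf closes that junction FROM NODE U2's SIDE:

* §1 `ne4_of_margNE9_NE5` — node U2's TRIPLE `ScaleShiftRate ∧ HistLipschitz ∧ FadingMemory` from row NE9's marginal-
  projection END with **`r := shiftRead rA`, `rA` = node U2's OWN read-out of (R)**: the SAME recipe (1.20)–(1.22) p. 264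
  of [I] that reads β off the term family re-attaches the coupling-renormalization counterterm of (1.3) p. 260.  The END's
  `ReadSize` is DISCHARGED from U2's displayed `hr : ReadBoundedOn 𝒜A rA κ cr` (+ `Adm ⊆ 𝒜A`, `0 ∈ 𝒜A`); `ReadZero` /
  `ReadAdditive` from the linearity binders `hrA0` / `hrAadd` (printed STRUCTURE: (1.20) is a second variational derivative
  — THEOREMS for probe recipes, sibling module); the old faces' class binder `h𝒜A` is DERIVED from `AdmissibleTerms` + `Adm ⊆ 𝒜A`.  Row
  NE5 enters BY SHAPE (`hNE5f : ∀ b′ ∈ ]0, γ], NE5 EA (EBfam b′) W κ θ₅ C₅`, datum-uniform constants displayed) — discharged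
  by ANY row-NE5 END face (`OutputRateResidual` p197255, `OutputRateInsertion` p202795, `OutputRateTowerSocket` p203601,
  `OutputRateTowerInstance` p205877) with its own leaf table.  Memory rate `ν = ω + 8·lipbar·B·((1 + cr·aA)·τ̄)`: node
  U2's read-out constant `cr` now sits INSIDE the memory rate.
* §2 `injectedRate_of_margNE9_NE5` — node U2's OUTPUT `T4CauchySum.InjectedRate (2(cr·C₅·θ₅)/(1 − ρ)) 0 ρ (disc of the
  runs)` by the GAP route `T4CurrencyMatching.injectedRate_of_runs_gap` (the discrete-Grönwall closure of the two-sided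
  matching recursion; NO asymptotic-freedom input).  The memory GAP scalar now reads `ω + 8·lipbar·B·((1 + cr·aA)·τ̄) < ρ`
  (`memoryGap_of_smallness`, §0): a smallness of the per-step weight `τ̄` AGAINST node U2's own read-out constant.
* §3 `uRateUpTo_of_margNE9_NE5` — the spine's `K`-UNIFORM `URateUpTo K` (`T4TowerRateDischarge.uRateUpTo_of_nodes` with
  `hinj :=` §2), row NE5 for the tower pair BY SHAPE.
Sibling `Support/NE4ReadOutSocketMarginalRecipe` (same generation): the EXACTNESS of the dictionary at node U2's read-out (the
projected family on the scale-(k+1) slice IS `EA (extd v) − β k v · A`, the summand of (1.3) p. 260 with the cell's β) and the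
PROBE-RECIPE discharge (`T4BetaReadOutLipschitz.Probes`: `ReadZero` / `ReadAdditive` / `ReadSize` and hence §1's `hrA0` /
`hrAadd` / `hr` / `hcov` / `h0A` are THEOREMS, cr = 8K/α²) — §1's triple with NO read-out binder left.

WHAT IS PROVED: bookkeeping only (compositions of the imported theorems BY NAME, `subst` of two displayed abbreviations, sign
computations).  0 sorry; axioms ⊆ {propext, Classical.choice, Quot.sound}; imports the LANDED modules `T4TowerRateDischarge`,
`T4BetaReadOutLipschitz`, `T4CurrencyMatching`, `Support/NE9MarginalProjectionEnd` (p208940) and modifies nothing of them.  NOT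
COVERED: any instance of a binder for Bałaban's objects; NE2, NE3, NE5, NE9, BetaPertH, (B), (B^μ); the asymptotic-freedom route
(`EventualLowerH`); the t-currency twin (`T4CurrencyMatching.HistLipschitzBy`, `NE4ReadOutSocketGaussian`) — not restated.  Rung
(B)+1 finite T⁴; NOT summit progress.

References (TYPES/STRUCTURE only): [Balaban1987RG1] CMP 109 (1987) (0.20) p. 256, (1.3) p. 260, (1.18) p. 263, (1.20)–(1.22)
p. 264; [Balaban1988RG2Cluster] CMP 116 (1988) p. 8 l. 9–10, (1.36) p. 9, Lemma 3 (2.38) p. 20.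
-/

noncomputable section

namespace Summit.QuantumFields.BalabanUV.T4Continuum.NE4ReadOutSocketMarginal

open scoped BigOperators
open Literature.MathematicalPhysics.QuantumFieldTheory.Balaban1983to89
open FlowStep (HBeta RGEqH Box)
open T4OutputRate (Carriers Functional NE5 NE9 LipBackground)
open T4CouplingMatching (disc ScaleShiftRate HistLipschitz)
open T4CauchySum (InjectedRate)
open T4EtaRateMin (Readings LocalRate)
open T4RateLiaison (GaugeDominated)
open T4TowerRateComposition (URateUpTo PolyLipGrowth)
open T4TowerRateDischarge (uRateUpTo_of_nodes)
open T4BetaReadOut (Slice ReadOut RepresentsA RepresentsB)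
open T4BetaReadOutLipschitz (ReadBoundedOn ReadCovariantOn ne4_of_u3_on)
open T4FlagMemory (extd)
open T4HistoryLipschitzRecursion (prodModuli restrictScale ScaleZeroFree AdmissibleTerms AdmRestrict ChannelAdditive
  ChannelStepSum ChannelSizeAtStepNN)
open T4HistoryLipschitzOuter (Factorises)
open T4HistoryLipschitzActivity (ClusterGeom)
open T4HistoryLipschitzSegment (TwoPointKP TermSize sizeRadius)
open NE9MarginalProjection (compProj margProj shiftRead ReadAdditive ReadZero ReadSize DirSize ProjAdditive ProjScaleComm
  ProjInto ProjSize projAdditive_margProj projScaleComm_margProj projSize_margProj readZero_shiftRead readAdditive_shiftRead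
  readSize_of_readBoundedOn)
open NE9MarginalProjectionEnd (ne9_and_fadingMemory_of_couplingTwoPoint_vacSub_sizeInduction_compProj)

variable {C : Carriers} {ι X : Type}

/-! ## §0 Scalars: the memory gap with node U2's read-out constant inside -/

/-- **L5 MEMORY GAP (scalar)** in the marginal-projection booking: the memory rate `ω + 8·lipbar·B·((1 + cr·aA)·τ̄)` of
row NE9's END carries node U2's read-out constant `cr`; the gap below the matching rate `ρ` holds as soon as the feedback
gain is at most half the margin `ρ − ω` — a smallness of the per-step weight `τ̄` against `cr` (for probe recipes
`cr = 8K/α²`, sibling `NE4ReadOutSocketMarginalRecipe`), NOT of `cr`.  The inequality is ours; only its letters are printed. [folklore] -/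
theorem memoryGap_of_smallness {ω ρ lipbar B cr aA τbar : ℝ}
    (h : 8 * lipbar * B * ((1 + cr * aA) * τbar) ≤ (ρ - ω) / 2) (hωρ : ω < ρ) :
    ω + 8 * lipbar * B * ((1 + cr * aA) * τbar) < ρ := by
  linarith

/-- The constant of a `T4CouplingMatching.FadingMemory` profile is nonnegative. [folklore] -/
theorem fadingMemory_const_nonneg {Cm θ : ℝ} {Λ : ℕ → ℕ → ℝ} (h : T4CouplingMatching.FadingMemory Cm θ Λ) : 0 ≤ Cm := by
  have h0 := h 0 0 le_rfl
  simpa using h0.1.trans h0.2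

/-! ## §1 Node U2's triple from row NE9's marginal-projection END, row NE5 by shape, and the read-out (R) -/

/-- **ROW NE4 — NODE U2's TRIPLE ON ROW NE9's MARGINAL-PROJECTION END, ONE READ-OUT USED TWICE.**  Binders: (NE9-END)
those of `NE9MarginalProjectionEnd.ne9_and_fadingMemory_of_couplingTwoPoint_vacSub_sizeInduction_compProj` at
`P := margProj (shiftRead rA) A`, verbatim, EXCEPT the four projection binders: `ProjAdditive` ⇐ `hrAadd`, `ProjScaleComm`
⇐ `hrA0`, `ProjSize` ⇐ node U2's `hr : ReadBoundedOn 𝒜A rA κ cr` + `hAdmA : Adm ⊆ 𝒜A` + `h0A : 0 ∈ 𝒜A` + `hDir : DirSize A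
κ aA` (junction `readSize_of_readBoundedOn`), `ProjInto` displayed (`hPinto`: the projected admissible families are
marginal-free — `rA` normalised against `A`); the constants `ℓ`, `ν` abbreviated by `hℓ`/`hν`.  (NE5) BY SHAPE: `hNE5f`,
datum-uniform `θ₅`, `C₅`.  (R) `hW`, `hA`, `hB`, `h𝒜B`, `hr`, `hcov`, `hcr`; the run-A class binder of the older faces is
DERIVED (`hAdmA (hAdm.1 g hg)`).  Conclusion = `T4BetaReadOutLipschitz.ne4_of_u3_on`: constants `cr·C₅·θ₅`, `cr·Λ(k+1)`,
`cr·(ℓ/ν)·ν`, `Λ = prodModuli ℓ (fun _ ↦ ν)`, `ℓ = 8·clipbar·B + 8·lipbar·B·qTbar`, `ν = ω + 8·lipbar·B·((1 + cr·aA)·τ̄)`.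
[folklore] -/
theorem ne4_of_margNE9_NE5 (G : ClusterGeom C) {Pot : Type*} [NormedAddCommGroup Pot] [NormedSpace ℂ Pot]
    {ιc : Type} {EA : Functional C C.BgA} {W : Set (ℕ → ℝ)} {Adm MF : Set (C.BgA → C.Dom → ℝ)}
    {A : C.BgA → C.Dom → ℝ} {𝒯 : ℕ → (ℕ → ℝ) → (C.BgA → C.Dom → ℝ) → ιc → ℝ}
    {Ψ : ℕ → ℝ → (ιc → ℝ) → C.BgA → C.Dom → ℝ} {act : ℕ → ℝ → C.BgA → Pot → G.P → ℂ} {𝒜 : ℕ → Set Pot}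
    {n : ℕ → ℝ → C.BgA → G.P → ℝ} {lip clip : ℕ → ℝ} {aP dP : G.P → ℝ} {δ : C.Dom → ℝ}
    {κ B lipbar clipbar qTbar τbar ω aA ℓ ν : ℝ} {wt : ℕ → ιc → ℝ} {τ : ℕ → ℕ → ℝ} {qT p₀ N : ℕ → ℝ}
    (ρT : ℕ → (ιc → ℝ) → Pot) (U₀ : C.BgA) (explZ : ℕ → C.BgA → C.Dom → ℝ)
    {𝒜A : Set (Slice C C.BgA)} {𝒜B : Set (Slice C C.BgB)} {rA : ReadOut C C.BgA} {rB : ReadOut C C.BgB} {β : HBeta}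
    {cr γ : ℝ}
    -- ===== row NE9's marginal-projection END at `P := margProj (shiftRead rA) A` =====
    (h0 : ScaleZeroFree EA W) (hAdm : AdmissibleTerms EA W Adm) (hres : AdmRestrict Adm)
    (hDir : DirSize A κ aA) (haA : 0 ≤ aA) (hPinto : ProjInto Adm MF (margProj (shiftRead rA) A))
    (hadd : ChannelAdditive MF 𝒯) (hsum : ChannelStepSum MF 𝒯) (hstep : ChannelSizeAtStepNN MF 𝒯 κ wt τ)
    (hfac : Factorises EA W (compProj 𝒯 (margProj (shiftRead rA) A)) Ψ) (hclip0 : ∀ k, 0 ≤ clip k)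
    (hCup : ∀ g ∈ W, ∀ g' ∈ W, ∀ (k : ℕ) (U : C.BgA) (X : C.Dom), C.scale X = k + 1 → ∀ Q ∈ 𝒜 k, ∀ γ' ∈ G.vol X,
      ‖act k (g k) U Q γ'‖ ≤ n k (g' k) U γ' ∧
        ‖act k (g k) U Q γ' - act k (g' k) U Q γ'‖ ≤ clip k * |g k - g' k| * n k (g' k) U γ')
    (hqT0 : ∀ k, 0 ≤ qT k)
    (hTcup : ∀ g ∈ W, ∀ g' ∈ W, ∀ (k : ℕ) (y : ιc),
      |compProj 𝒯 (margProj (shiftRead rA) A) k g (EA g) y - compProj 𝒯 (margProj (shiftRead rA) A) k g' (EA g) y| ≤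
        wt k y * (qT k * |g k - g' k|))
    (hreprV : ∀ (k : ℕ) (s : ℝ) (Q : ιc → ℝ) (U : C.BgA) (X : C.Dom),
      Ψ k s Q U X = (G.newTerm act k s U X (ρT k Q)).re - (G.newTerm act k s U₀ X (ρT k Q)).re + explZ k U X)
    (hclipb : ∀ k, clip k ≤ clipbar) (hqTb : ∀ k, qT k ≤ qTbar)
    (hKP : TwoPointKP G W act 𝒜 n lip aP dP) (hdec : G.DecayExtract δ dP) (hpinB : G.PinBudget aP δ (fun _ => B) κ)
    (hρT : ∀ (k : ℕ) (Q Q' : ιc → ℝ) (M : ℝ), (∀ y, |Q y - Q' y| ≤ wt k y * M) → ‖ρT k Q - ρT k Q'‖ ≤ M)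
    (hexplZ : ∀ (k : ℕ) (U : C.BgA) (X : C.Dom), C.scale X = k + 1 → |explZ k U X| ≤ Real.exp (-(κ * C.d X)) * p₀ k)
    (hbase : ∀ g ∈ W, ∀ (U : C.BgA) (X : C.Dom), C.scale X = 0 → |EA g U X| ≤ Real.exp (-(κ * C.d X)) * N 0)
    (hNsucc : ∀ j, p₀ j + 2 * B ≤ N (j + 1)) (hNnn : ∀ j, 0 ≤ N j)
    (hbox : ∀ (k : ℕ) (Q : ιc → ℝ),
      (∀ y, |Q y| ≤ wt k y * sizeRadius (fun k j => (1 + cr * aA) * τ k j) N k) → ρT k Q ∈ 𝒜 k)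
    (hB0 : 0 ≤ B) (hlipb : ∀ k, lip k ≤ lipbar) (hτbar : 0 ≤ τbar) (hω : 0 ≤ ω)
    (hpos : 0 < ω + 8 * lipbar * B * ((1 + cr * aA) * τbar))
    (hτ : ∀ k j, j ≤ k → 0 ≤ τ k j ∧ τ k j ≤ τbar * ω ^ (k - j))
    (hℓ : 8 * clipbar * B + 8 * lipbar * B * qTbar = ℓ) (hν : ω + 8 * lipbar * B * ((1 + cr * aA) * τbar) = ν)
    -- ===== row NE5 BY SHAPE, read-out family (`EA`, `EBfam b′`), datum-uniform constants =====
    {EBfam : ℝ → Functional C C.BgB} {θ₅ C₅ : ℝ} (hNE5f : ∀ b', 0 < b' → b' ≤ γ → NE5 EA (EBfam b') W κ θ₅ C₅)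
    -- ===== node U2's read-out (R): ONE read-out `rA`, used by (R) AND by the projection =====
    (hW : ∀ k (v : Fin (k + 1) → ℝ), v ∈ Box γ k → extd v ∈ W)
    (hA : RepresentsA EA rA γ β) (hB : RepresentsB EBfam rB γ β) (hAdmA : Adm ⊆ 𝒜A) (h0A : (0 : Slice C C.BgA) ∈ 𝒜A)
    (h𝒜B : ∀ b', 0 < b' → b' ≤ γ → ∀ g' ∈ W, EBfam b' g' ∈ 𝒜B)
    (hr : ReadBoundedOn 𝒜A rA κ cr) (hcov : ReadCovariantOn 𝒜A 𝒜B rA rB κ cr) (hcr : 0 ≤ cr)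
    (hrA0 : ∀ k, rA k 0 = 0)
    (hrAadd : ∀ k, ∀ H₁ ∈ Adm, ∀ H₂ ∈ Adm, rA k (restrictScale (k + 1) (H₁ - H₂)) =
      rA k (restrictScale (k + 1) H₁) - rA k (restrictScale (k + 1) H₂)) :
    ScaleShiftRate (cr * C₅ * θ₅) θ₅ γ β ∧
      HistLipschitz (fun k i => cr * prodModuli ℓ (fun _ => ν) (k + 1) i) γ β ∧
        T4CouplingMatching.FadingMemory (cr * (ℓ / ν) * ν) ν (fun k i => cr * prodModuli ℓ (fun _ => ν) (k + 1) i) := by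
  subst hℓ hν
  have hrs : ReadSize Adm (shiftRead rA) κ cr :=
    readSize_of_readBoundedOn hr h0A (fun H hH j => hAdmA (hres.1 H hH j)) hrA0 hcr
  have hK := ne9_and_fadingMemory_of_couplingTwoPoint_vacSub_sizeInduction_compProj G ρT U₀ explZ h0 hAdm hres
    (projAdditive_margProj A (readAdditive_shiftRead hrAadd)) (projScaleComm_margProj Adm A (readZero_shiftRead hrA0))
    hPinto (projSize_margProj hrs hDir hcr) (mul_nonneg hcr haA) hadd hsum hstep hfac hclip0 hCup hqT0 hTcup hreprV hclipb
    hqTb hKP hdec hpinB hρT hexplZ hbase hNsucc hNnn hbox hB0 hlipb hτbar hω hpos hτ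
  exact ne4_of_u3_on hW hNE5f hK.2.1 hK.2.2 hA hB (fun g hg => hAdmA (hAdm.1 g hg)) h𝒜B hr hcov hcr

/-! ## §2 Node U2's output in the spine's currency (gap route) -/

/-- **ROW NE4 — NODE U2's OUTPUT `InjectedRate` ON ROW NE9's MARGINAL-PROJECTION END.**  §1's binders plus node U1/H3's
runs of (0.20) with history (`hrun`), the printed box (`hgbox`), the infrared pin (`hpin`), the signs `0 ≤ θ₅`, `0 ≤ C₅`,
the rates `θ₅ ≤ ρ`, `0 < ρ < 1`, the MEMORY GAP `hνρ : ν < ρ` — i.e. `ω + 8·lipbar·B·((1 + cr·aA)·τ̄) < ρ`, node U2's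
read-out constant inside (`memoryGap_of_smallness`) — and the window `hsmall`; conclusion =
`T4CurrencyMatching.injectedRate_of_runs_gap` on §1's triple.  NO `EventualLowerH`. [folklore] -/
theorem injectedRate_of_margNE9_NE5 (G : ClusterGeom C) {Pot : Type*} [NormedAddCommGroup Pot] [NormedSpace ℂ Pot]
    {ιc : Type} {EA : Functional C C.BgA} {W : Set (ℕ → ℝ)} {Adm MF : Set (C.BgA → C.Dom → ℝ)}
    {A : C.BgA → C.Dom → ℝ} {𝒯 : ℕ → (ℕ → ℝ) → (C.BgA → C.Dom → ℝ) → ιc → ℝ}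
    {Ψ : ℕ → ℝ → (ιc → ℝ) → C.BgA → C.Dom → ℝ} {act : ℕ → ℝ → C.BgA → Pot → G.P → ℂ} {𝒜 : ℕ → Set Pot}
    {n : ℕ → ℝ → C.BgA → G.P → ℝ} {lip clip : ℕ → ℝ} {aP dP : G.P → ℝ} {δ : C.Dom → ℝ}
    {κ B lipbar clipbar qTbar τbar ω aA ℓ ν : ℝ} {wt : ℕ → ιc → ℝ} {τ : ℕ → ℕ → ℝ} {qT p₀ N : ℕ → ℝ}
    (ρT : ℕ → (ιc → ℝ) → Pot) (U₀ : C.BgA) (explZ : ℕ → C.BgA → C.Dom → ℝ)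
    {𝒜A : Set (Slice C C.BgA)} {𝒜B : Set (Slice C C.BgB)} {rA : ReadOut C C.BgA} {rB : ReadOut C C.BgB} {β : HBeta}
    {cr γ : ℝ}
    (h0 : ScaleZeroFree EA W) (hAdm : AdmissibleTerms EA W Adm) (hres : AdmRestrict Adm)
    (hDir : DirSize A κ aA) (haA : 0 ≤ aA) (hPinto : ProjInto Adm MF (margProj (shiftRead rA) A))
    (hadd : ChannelAdditive MF 𝒯) (hsum : ChannelStepSum MF 𝒯) (hstep : ChannelSizeAtStepNN MF 𝒯 κ wt τ)
    (hfac : Factorises EA W (compProj 𝒯 (margProj (shiftRead rA) A)) Ψ) (hclip0 : ∀ k, 0 ≤ clip k)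
    (hCup : ∀ g ∈ W, ∀ g' ∈ W, ∀ (k : ℕ) (U : C.BgA) (X : C.Dom), C.scale X = k + 1 → ∀ Q ∈ 𝒜 k, ∀ γ' ∈ G.vol X,
      ‖act k (g k) U Q γ'‖ ≤ n k (g' k) U γ' ∧
        ‖act k (g k) U Q γ' - act k (g' k) U Q γ'‖ ≤ clip k * |g k - g' k| * n k (g' k) U γ')
    (hqT0 : ∀ k, 0 ≤ qT k)
    (hTcup : ∀ g ∈ W, ∀ g' ∈ W, ∀ (k : ℕ) (y : ιc),
      |compProj 𝒯 (margProj (shiftRead rA) A) k g (EA g) y - compProj 𝒯 (margProj (shiftRead rA) A) k g' (EA g) y| ≤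
        wt k y * (qT k * |g k - g' k|))
    (hreprV : ∀ (k : ℕ) (s : ℝ) (Q : ιc → ℝ) (U : C.BgA) (X : C.Dom),
      Ψ k s Q U X = (G.newTerm act k s U X (ρT k Q)).re - (G.newTerm act k s U₀ X (ρT k Q)).re + explZ k U X)
    (hclipb : ∀ k, clip k ≤ clipbar) (hqTb : ∀ k, qT k ≤ qTbar)
    (hKP : TwoPointKP G W act 𝒜 n lip aP dP) (hdec : G.DecayExtract δ dP) (hpinB : G.PinBudget aP δ (fun _ => B) κ)
    (hρT : ∀ (k : ℕ) (Q Q' : ιc → ℝ) (M : ℝ), (∀ y, |Q y - Q' y| ≤ wt k y * M) → ‖ρT k Q - ρT k Q'‖ ≤ M)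
    (hexplZ : ∀ (k : ℕ) (U : C.BgA) (X : C.Dom), C.scale X = k + 1 → |explZ k U X| ≤ Real.exp (-(κ * C.d X)) * p₀ k)
    (hbase : ∀ g ∈ W, ∀ (U : C.BgA) (X : C.Dom), C.scale X = 0 → |EA g U X| ≤ Real.exp (-(κ * C.d X)) * N 0)
    (hNsucc : ∀ j, p₀ j + 2 * B ≤ N (j + 1)) (hNnn : ∀ j, 0 ≤ N j)
    (hbox : ∀ (k : ℕ) (Q : ιc → ℝ),
      (∀ y, |Q y| ≤ wt k y * sizeRadius (fun k j => (1 + cr * aA) * τ k j) N k) → ρT k Q ∈ 𝒜 k)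
    (hB0 : 0 ≤ B) (hlipb : ∀ k, lip k ≤ lipbar) (hτbar : 0 ≤ τbar) (hω : 0 ≤ ω)
    (hpos : 0 < ω + 8 * lipbar * B * ((1 + cr * aA) * τbar))
    (hτ : ∀ k j, j ≤ k → 0 ≤ τ k j ∧ τ k j ≤ τbar * ω ^ (k - j))
    (hℓ : 8 * clipbar * B + 8 * lipbar * B * qTbar = ℓ) (hν : ω + 8 * lipbar * B * ((1 + cr * aA) * τbar) = ν)
    {EBfam : ℝ → Functional C C.BgB} {θ₅ C₅ : ℝ} (hNE5f : ∀ b', 0 < b' → b' ≤ γ → NE5 EA (EBfam b') W κ θ₅ C₅)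
    (hθ₅0 : 0 ≤ θ₅) (hC₅ : 0 ≤ C₅)
    (hW : ∀ k (v : Fin (k + 1) → ℝ), v ∈ Box γ k → extd v ∈ W)
    (hA : RepresentsA EA rA γ β) (hB : RepresentsB EBfam rB γ β) (hAdmA : Adm ⊆ 𝒜A) (h0A : (0 : Slice C C.BgA) ∈ 𝒜A)
    (h𝒜B : ∀ b', 0 < b' → b' ≤ γ → ∀ g' ∈ W, EBfam b' g' ∈ 𝒜B)
    (hr : ReadBoundedOn 𝒜A rA κ cr) (hcov : ReadCovariantOn 𝒜A 𝒜B rA rB κ cr) (hcr : 0 ≤ cr)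
    (hrA0 : ∀ k, rA k 0 = 0)
    (hrAadd : ∀ k, ∀ H₁ ∈ Adm, ∀ H₂ ∈ Adm, rA k (restrictScale (k + 1) (H₁ - H₂)) =
      rA k (restrictScale (k + 1) H₁) - rA k (restrictScale (k + 1) H₂))
    -- ===== node U1/H3's runs, the rates, the memory gap and the window =====
    {ρ : ℝ} (g : ℕ → ℕ → ℝ) (gIR : ℝ) (hθ₅ρ : θ₅ ≤ ρ) (hνρ : ν < ρ) (hρ0 : 0 < ρ) (hρ1 : ρ < 1) (hγ : 0 ≤ γ)
    (hrun : ∀ K, RGEqH K β (g K)) (hgbox : ∀ K i, i ≤ K → 0 < g K i ∧ g K i ≤ γ) (hpin : ∀ K, g K K = gIR)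
    (hsmall : cr * (ℓ / ν) * ν * (γ ^ 3 / 2) * (ρ / (ρ - ν)) ≤ (1 - ρ) / 2) :
    InjectedRate (2 * (cr * C₅ * θ₅) / (1 - ρ)) 0 ρ (fun K j => disc (g K) (g (K + 1)) j) := by
  obtain ⟨hS, hL, hM⟩ := ne4_of_margNE9_NE5 G ρT U₀ explZ h0 hAdm hres hDir haA hPinto hadd hsum hstep hfac hclip0 hCup
    hqT0 hTcup hreprV hclipb hqTb hKP hdec hpinB hρT hexplZ hbase hNsucc hNnn hbox hB0 hlipb hτbar hω hpos hτ hℓ hν hNE5f hW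
    hA hB hAdmA h0A h𝒜B hr hcov hcr hrA0 hrAadd
  have hν0 : 0 ≤ ν := by rw [← hν]; exact hpos.le
  exact T4CurrencyMatching.injectedRate_of_runs_gap g gIR hρ0 hρ1 hθ₅0 hθ₅ρ hν0 hνρ
    (mul_nonneg (mul_nonneg hcr hC₅) hθ₅0) (fadingMemory_const_nonneg hM) hγ hrun hgbox hpin hS hL hM hsmall

/-! ## §3 The spine's `K`-uniform term-wise matching -/

/-- **ROW NE4 IN THE SPINE — `URateUpTo K`, `K`-UNIFORM, ON ROW NE9's MARGINAL-PROJECTION END.**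
`T4TowerRateDischarge.uRateUpTo_of_nodes` with: `h9`/`hΛ` := row NE9's marginal-projection END (binders as in §1, the
projection read by node U2's `rA`); `h5` := row NE5 for the TOWER PAIR (`EA`, `EB`) BY SHAPE (`hNE5`); `hinj` := §2; node
U1b `hU`/`hG`/`hP`; nodes U5/U6 `hloc`/`hgd`; the runs in `W`; target rate `θ′ > max ν ρ`.  Constant
`a + (ℓ/ν)·(γ³·2(cr·C₅·θ₅)/(1 − ρ))·θ′/(θ′ − max ν ρ) + C₅`.  One-carrier composition (cf. `NE4ReadOutSocket`, header
ONE-CARRIER CONVENTION). [folklore] -/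
theorem uRateUpTo_of_margNE9_NE5 (G : ClusterGeom C) {Pot : Type*} [NormedAddCommGroup Pot] [NormedSpace ℂ Pot]
    {ιc : Type} {EA : Functional C C.BgA} {W : Set (ℕ → ℝ)} {Adm MF : Set (C.BgA → C.Dom → ℝ)}
    {A : C.BgA → C.Dom → ℝ} {𝒯 : ℕ → (ℕ → ℝ) → (C.BgA → C.Dom → ℝ) → ιc → ℝ}
    {Ψ : ℕ → ℝ → (ιc → ℝ) → C.BgA → C.Dom → ℝ} {act : ℕ → ℝ → C.BgA → Pot → G.P → ℂ} {𝒜 : ℕ → Set Pot}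
    {n : ℕ → ℝ → C.BgA → G.P → ℝ} {lip clip : ℕ → ℝ} {aP dP : G.P → ℝ} {δ : C.Dom → ℝ}
    {κ B lipbar clipbar qTbar τbar ω aA ℓ ν : ℝ} {wt : ℕ → ιc → ℝ} {τ : ℕ → ℕ → ℝ} {qT p₀ N : ℕ → ℝ}
    (ρT : ℕ → (ιc → ℝ) → Pot) (U₀ : C.BgA) (explZ : ℕ → C.BgA → C.Dom → ℝ)
    {𝒜A : Set (Slice C C.BgA)} {𝒜B : Set (Slice C C.BgB)} {rA : ReadOut C C.BgA} {rB : ReadOut C C.BgB} {β : HBeta}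
    {cr γ : ℝ}
    (h0 : ScaleZeroFree EA W) (hAdm : AdmissibleTerms EA W Adm) (hres : AdmRestrict Adm)
    (hDir : DirSize A κ aA) (haA : 0 ≤ aA) (hPinto : ProjInto Adm MF (margProj (shiftRead rA) A))
    (hadd : ChannelAdditive MF 𝒯) (hsum : ChannelStepSum MF 𝒯) (hstep : ChannelSizeAtStepNN MF 𝒯 κ wt τ)
    (hfac : Factorises EA W (compProj 𝒯 (margProj (shiftRead rA) A)) Ψ) (hclip0 : ∀ k, 0 ≤ clip k)
    (hCup : ∀ g ∈ W, ∀ g' ∈ W, ∀ (k : ℕ) (U : C.BgA) (X : C.Dom), C.scale X = k + 1 → ∀ Q ∈ 𝒜 k, ∀ γ' ∈ G.vol X,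
      ‖act k (g k) U Q γ'‖ ≤ n k (g' k) U γ' ∧
        ‖act k (g k) U Q γ' - act k (g' k) U Q γ'‖ ≤ clip k * |g k - g' k| * n k (g' k) U γ')
    (hqT0 : ∀ k, 0 ≤ qT k)
    (hTcup : ∀ g ∈ W, ∀ g' ∈ W, ∀ (k : ℕ) (y : ιc),
      |compProj 𝒯 (margProj (shiftRead rA) A) k g (EA g) y - compProj 𝒯 (margProj (shiftRead rA) A) k g' (EA g) y| ≤
        wt k y * (qT k * |g k - g' k|))
    (hreprV : ∀ (k : ℕ) (s : ℝ) (Q : ιc → ℝ) (U : C.BgA) (X : C.Dom),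
      Ψ k s Q U X = (G.newTerm act k s U X (ρT k Q)).re - (G.newTerm act k s U₀ X (ρT k Q)).re + explZ k U X)
    (hclipb : ∀ k, clip k ≤ clipbar) (hqTb : ∀ k, qT k ≤ qTbar)
    (hKP : TwoPointKP G W act 𝒜 n lip aP dP) (hdec : G.DecayExtract δ dP) (hpinB : G.PinBudget aP δ (fun _ => B) κ)
    (hρT : ∀ (k : ℕ) (Q Q' : ιc → ℝ) (M : ℝ), (∀ y, |Q y - Q' y| ≤ wt k y * M) → ‖ρT k Q - ρT k Q'‖ ≤ M)
    (hexplZ : ∀ (k : ℕ) (U : C.BgA) (X : C.Dom), C.scale X = k + 1 → |explZ k U X| ≤ Real.exp (-(κ * C.d X)) * p₀ k)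
    (hbase : ∀ g ∈ W, ∀ (U : C.BgA) (X : C.Dom), C.scale X = 0 → |EA g U X| ≤ Real.exp (-(κ * C.d X)) * N 0)
    (hNsucc : ∀ j, p₀ j + 2 * B ≤ N (j + 1)) (hNnn : ∀ j, 0 ≤ N j)
    (hbox : ∀ (k : ℕ) (Q : ιc → ℝ),
      (∀ y, |Q y| ≤ wt k y * sizeRadius (fun k j => (1 + cr * aA) * τ k j) N k) → ρT k Q ∈ 𝒜 k)
    (hB0 : 0 ≤ B) (hlipb : ∀ k, lip k ≤ lipbar) (hτbar : 0 ≤ τbar) (hω : 0 ≤ ω)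
    (hpos : 0 < ω + 8 * lipbar * B * ((1 + cr * aA) * τbar))
    (hτ : ∀ k j, j ≤ k → 0 ≤ τ k j ∧ τ k j ≤ τbar * ω ^ (k - j))
    (hℓ : 8 * clipbar * B + 8 * lipbar * B * qTbar = ℓ) (hν : ω + 8 * lipbar * B * ((1 + cr * aA) * τbar) = ν)
    -- ===== row NE5 BY SHAPE: tower pair (`EA`, `EB`) and read-out family (`EA`, `EBfam b′`), same constants =====
    {EB : Functional C C.BgB} {EBfam : ℝ → Functional C C.BgB} {θ₅ C₅ : ℝ} (hNE5 : NE5 EA EB W κ θ₅ C₅)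
    (hNE5f : ∀ b', 0 < b' → b' ≤ γ → NE5 EA (EBfam b') W κ θ₅ C₅) (hθ₅0 : 0 ≤ θ₅) (hC₅ : 0 ≤ C₅)
    (hW : ∀ k (v : Fin (k + 1) → ℝ), v ∈ Box γ k → extd v ∈ W)
    (hA : RepresentsA EA rA γ β) (hB : RepresentsB EBfam rB γ β) (hAdmA : Adm ⊆ 𝒜A) (h0A : (0 : Slice C C.BgA) ∈ 𝒜A)
    (h𝒜B : ∀ b', 0 < b' → b' ≤ γ → ∀ g' ∈ W, EBfam b' g' ∈ 𝒜B)
    (hr : ReadBoundedOn 𝒜A rA κ cr) (hcov : ReadCovariantOn 𝒜A 𝒜B rA rB κ cr) (hcr : 0 ≤ cr)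
    (hrA0 : ∀ k, rA k 0 = 0)
    (hrAadd : ∀ k, ∀ H₁ ∈ Adm, ∀ H₂ ∈ Adm, rA k (restrictScale (k + 1) (H₁ - H₂)) =
      rA k (restrictScale (k + 1) H₁) - rA k (restrictScale (k + 1) H₂))
    {ρ : ℝ} {g : ℕ → ℕ → ℝ} (gIR : ℝ) (hθ₅ρ : θ₅ ≤ ρ) (hνρ : ν < ρ) (hρ0 : 0 < ρ) (hρ1 : ρ < 1) (hγ : 0 ≤ γ)
    (hrun : ∀ K, RGEqH K β (g K)) (hgbox : ∀ K i, i ≤ K → 0 < g K i ∧ g K i ≤ γ) (hpin : ∀ K, g K K = gIR)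
    (hsmall : cr * (ℓ / ν) * ν * (γ ^ 3 / 2) * (ρ / (ρ - ν)) ≤ (1 - ρ) / 2)
    (hgA : ∀ K, g K ∈ W) (hgB : ∀ K, (fun i => g (K + 1) (i + 1)) ∈ W)
    -- ===== node U1b, nodes U5/U6, the target rate =====
    {R : Readings ι X} {C₃ θ₃ P θ' : ℝ} {q : ℕ} {CU : (ℕ → ℝ) → ℕ → ℝ} {uA : ℕ → ι → C.BgA} {uB : ℕ → ι → C.BgB}
    (hU : LipBackground EA W κ CU) (hG : PolyLipGrowth CU g P q) (hP : 0 ≤ P)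
    (hloc : LocalRate R C₃ θ₃) (hC₃ : 0 ≤ C₃) (hθ₃ : 0 ≤ θ₃) (hθ₃1 : θ₃ < 1) (hgd : GaugeDominated R uA uB)
    (hθ' : max ν ρ < θ') (hθ₅' : θ₅ ≤ θ') (hθ₃' : θ₃ ≤ θ') :
    ∃ a : ℝ, 0 ≤ a ∧ ∀ K, URateUpTo K EA EB (g K) (fun i => g (K + 1) (i + 1)) (uA K) (uB K) R.dom
      (a + ℓ / ν * (γ ^ 3 * (2 * (cr * C₅ * θ₅) / (1 - ρ))) * (θ' / (θ' - max ν ρ)) + C₅) θ' κ := by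
  have hinj := injectedRate_of_margNE9_NE5 G ρT U₀ explZ h0 hAdm hres hDir haA hPinto hadd hsum hstep hfac hclip0 hCup
    hqT0 hTcup hreprV hclipb hqTb hKP hdec hpinB hρT hexplZ hbase hNsucc hNnn hbox hB0 hlipb hτbar hω hpos hτ hℓ hν hNE5f
    hθ₅0 hC₅ hW hA hB hAdmA h0A h𝒜B hr hcov hcr hrA0 hrAadd g gIR hθ₅ρ hνρ hρ0 hρ1 hγ hrun hgbox hpin hsmall
  subst hℓ hν
  have hrs : ReadSize Adm (shiftRead rA) κ cr :=
    readSize_of_readBoundedOn hr h0A (fun H hH j => hAdmA (hres.1 H hH j)) hrA0 hcr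
  have hK := ne9_and_fadingMemory_of_couplingTwoPoint_vacSub_sizeInduction_compProj G ρT U₀ explZ h0 hAdm hres
    (projAdditive_margProj A (readAdditive_shiftRead hrAadd)) (projScaleComm_margProj Adm A (readZero_shiftRead hrA0))
    hPinto (projSize_margProj hrs hDir hcr) (mul_nonneg hcr haA) hadd hsum hstep hfac hclip0 hCup hqT0 hTcup hreprV hclipb
    hqTb hKP hdec hpinB hρT hexplZ hbase hNsucc hNnn hbox hB0 hlipb hτbar hω hpos hτ
  exact uRateUpTo_of_nodes hK.2.1 hK.2.2 hpos.le hU hG hP hNE5 hθ₅0 hC₅ hloc hC₃ hθ₃ hθ₃1 hgd hinj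
    (div_nonneg (mul_nonneg zero_le_two (mul_nonneg (mul_nonneg hcr hC₅) hθ₅0)) (by linarith)) hρ0.le
    hgbox hgA hgB hθ' hθ₅' hθ₃'

end Summit.QuantumFields.BalabanUV.T4Continuum.NE4ReadOutSocketMarginal

end
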